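import Literature.Analysis.FunctionSpaces.WightmanSpectralAverages
import Literature.Analysis.FunctionSpaces.SchwartzDistributionSupport
import Literature.MathematicalPhysics.QuantumFieldTheory.LorentzSpectralSupport
import HarnessLib

/-!
# The spectral condition of the Wightman distributions, II: proof of Thm. 3-2 (b)

Topic `Literature/Analysis/FunctionSpaces`. Discharge of the named fact
`Literature.MathematicalPhysics.QuantumLattice.IsWightmanQFT.hasSpectralCondition_family`
(`WightmanFunctionsFamilyProofs`; Streater–Wightman (1964), §3-3, Thm. 3-2 (b), eqs.
(3-27)–(3-32), pdf pp. 96–97 of the 2000 printing): the Wightman distributions `𝒲ₙ` of a Wightman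
QFT `W` have Fourier transforms supported in the spectral set
`{∑ pⱼ = 0, ∑_{j ≤ k} pⱼ ∈ V̄₊}` (`HasSpectralCondition`, test-function form).

Proof. Let `T̂ = 𝒲ₙ ∘ ♭⁻¹ ∘ 𝓕⁻¹` be the Fourier transform of `𝒲ₙ` as a functional on momentum-space
test functions on the flattening `ℝ^{n(1+d)}` (`♭ = flattenCLE`). By part I
(`WightmanSpectralAverages`), for the translation `A_m` of the arguments `j ≥ m` and a Schwartz
weight `g`, `𝒲ₙ(∫ 𝓕g(a) F(· − A_m a) da)` vanishes when `1 ≤ m` and `supp g ∩ V̄₊ = ∅` (W0), and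
equals `g(0) 𝒲ₙ(F)` when `m = 0` (translation invariance). On the Fourier side the averaged
translate is the multiplier `g(−Ã_m† p)` (`SchwartzAverage.fourier_translationAverage`,
`𝓕𝓕g = g(−·)`), where `Ã_m† p = ∑_{j ≥ m} pⱼ` (`adjoint_tail_apply`); hence
(`isVanishingOnCompact_tail`, `isVanishingOnCompact_all`, via the cutoff criterion
`SchwartzSupport.isVanishingOnCompact_preimage`) `T̂` vanishes near every momentum with
`−∑_{j ≥ m} pⱼ ∉ V̄₊` (`1 ≤ m`) or `∑ⱼ pⱼ ≠ 0`. These open sets cover the complement of the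
spectral set (`compl_image_spectralSet_subset`: if `∑ pⱼ = 0` and `∑_{j ≤ k} pⱼ ∉ V̄₊` then
`−∑_{j ≥ k+1} pⱼ = ∑_{j ≤ k} pⱼ`), and local vanishing glues
(`SchwartzSupport.isVanishingOn_iUnion`, Hörmander Thm. 2.2.1), giving
`IsWightmanQFT.hasSpectralCondition_family_holds`. No Lorentz invariance is used (the full cone
`V̄₊` comes directly from W0), and every space-time dimension `d ≥ 0` is covered.

## References

* R. F. Streater, A. S. Wightman, *PCT, Spin and Statistics, and All That*, §3-3, Thm. 3-2 (b),
  eqs. (3-27)–(3-32); §2-6. [StreaterWightman1964]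
* L. Hörmander, *The Analysis of Linear Partial Differential Operators I*, Thm. 2.2.1.
  [HormanderALPDO1]
-/

noncomputable section

open MeasureTheory Filter Set
open scoped SchwartzMap InnerProductSpace FourierTransform ContDiff
open Literature.MathematicalPhysics.QuantumLattice
open Literature.Analysis.UnboundedOperators

namespace Literature.Analysis.FunctionSpaces

variable {d : ℕ} {κ : Type*} {n : ℕ}

/-! ### The tail embeddings and their adjoints -/

/-- The translation of the arguments `j ≥ m` by `a ∈ ℝ^{1+d}` is a continuous linear map
`A_m : ℝ^{1+d} → (ℝ^{1+d})ⁿ`, `(A_m a)ⱼ = a` for `j ≥ m` and `0` otherwise. [folklore] -/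
theorem exists_tailEmbed (m : ℕ) :
    ∃ A : SpaceTime d →L[ℝ] (Fin n → SpaceTime d),
      ∀ (a : SpaceTime d) (j : Fin n), A a j = if m ≤ (j : ℕ) then a else 0 :=
  ⟨ContinuousLinearMap.pi fun j : Fin n =>
      if m ≤ (j : ℕ) then ContinuousLinearMap.id ℝ (SpaceTime d) else 0,
    fun a j => by
      rw [ContinuousLinearMap.pi_apply]
      split_ifs <;> rfl⟩

/-- **The adjoint of the flattened tail embedding is the tail momentum sum**:
`(♭ ∘ A_m)† p̃ = ∑_{j ≥ m} pⱼ`, `p = ♭⁻¹ p̃`. [folklore] -/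
theorem adjoint_tail_apply (A : SpaceTime d →L[ℝ] (Fin n → SpaceTime d)) {m : ℕ}
    (hA : ∀ (a : SpaceTime d) (j : Fin n), A a j = if m ≤ (j : ℕ) then a else 0)
    (q : EuclideanSpace ℝ (Fin n × Fin (d + 1))) :
    ContinuousLinearMap.adjoint ((flattenCLE d n : _ →L[ℝ] _).comp A) q =
      ∑ j : Fin n, if m ≤ (j : ℕ) then (flattenCLE d n).symm q j else 0 := by
  refine ext_inner_right ℝ fun a => ?_
  rw [ContinuousLinearMap.adjoint_inner_left, ContinuousLinearMap.comp_apply,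
    ContinuousLinearEquiv.coe_coe, sum_inner]
  conv_lhs => rw [← (flattenCLE d n).apply_symm_apply q]
  rw [Literature.MathematicalPhysics.QuantumFieldTheory.inner_flattenCLE]
  refine Finset.sum_congr rfl fun j _ => ?_
  rw [hA]
  split_ifs <;> simp

/-! ### The Fourier side -/

section FourierSide

variable (T : 𝓢((Fin n → SpaceTime d), ℂ) →L[ℂ] ℂ)

/-- Flattening after unflattening is the identity. [folklore] -/
theorem flattenTest_compCLM_flatten (G : 𝓢(EuclideanSpace ℝ (Fin n × Fin (d + 1)), ℂ)) :
    flattenTest (SchwartzMap.compCLMOfContinuousLinearEquiv ℂ (flattenCLE d n) G) = G := by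
  ext y
  simp [flattenTest_apply]

/-- **The averaged translate on the Fourier side**: for `T̂ = T ∘ ♭⁻¹ ∘ 𝓕⁻¹`,
`T̂((𝓕h ∘ Ã†) · Ĝ) = T(♭⁻¹ K_{Ã,h} ♭ (♭⁻¹ 𝓕⁻¹ Ĝ))` (`K_{Ã,h} = 𝓕⁻¹ (𝓕h ∘ Ã†) 𝓕`,
`SchwartzAverage.translationAverage_eq`). [folklore] -/
theorem fourierSide_apply_smulLeftCLM
    (Ã : SpaceTime d →L[ℝ] EuclideanSpace ℝ (Fin n × Fin (d + 1))) (h : 𝓢(SpaceTime d, ℂ))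
    (G : 𝓢(EuclideanSpace ℝ (Fin n × Fin (d + 1)), ℂ)) :
    ((T.comp (SchwartzMap.compCLMOfContinuousLinearEquiv ℂ (flattenCLE d n))).comp
        (FourierTransform.fourierInvCLM ℂ 𝓢(EuclideanSpace ℝ (Fin n × Fin (d + 1)), ℂ)))
        (SchwartzMap.smulLeftCLM ℂ (SchwartzAverage.averagingMultiplier Ã h) G) =
      T (SchwartzMap.compCLMOfContinuousLinearEquiv ℂ (flattenCLE d n)
        (SchwartzAverage.translationAverage Ã h
          (flattenTest (SchwartzMap.compCLMOfContinuousLinearEquiv ℂ (flattenCLE d n) (𝓕⁻ G))))) := by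
  rw [flattenTest_compCLM_flatten, SchwartzAverage.translationAverage_eq,
    FourierTransform.fourier_fourierInv_eq]
  rfl

/-- **The symbol for a cutoff weight**: with `g_θ = θ` (real, smooth, compactly supported, viewed
as a complex Schwartz function), `𝓕(𝓕g_θ)(Ã†p̃) = θ(−Ã†p̃)`. [folklore] -/
theorem averagingMultiplier_fourier_toSchwartzMap
    (Ã : SpaceTime d →L[ℝ] EuclideanSpace ℝ (Fin n × Fin (d + 1))) {θ : SpaceTime d → ℝ}
    (hθs : ContDiff ℝ ∞ fun x => (θ x : ℂ)) (hθc : HasCompactSupport fun x => (θ x : ℂ)) :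
    SchwartzAverage.averagingMultiplier Ã (𝓕 (hθc.toSchwartzMap hθs)) =
      fun q => ((θ ((-ContinuousLinearMap.adjoint Ã) q) : ℝ) : ℂ) := by
  funext q
  rw [SchwartzAverage.averagingMultiplier_apply,
    show ContinuousLinearMap.adjoint Ã q = -((-ContinuousLinearMap.adjoint Ã) q) by simp,
    ← Real.fourierInv_eq_fourier_neg, ← SchwartzMap.fourierInv_coe,
    FourierTransform.fourierInv_fourier_eq]
  rfl

end FourierSide

/-! ### Local vanishing of the Fourier transform of a Wightman distribution -/

section Vanishing

variable {W : WightmanData d κ} {k : Fin n → κ} {T : 𝓢((Fin n → SpaceTime d), ℂ) →L[ℂ] ℂ}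

/-- The closed forward cone is invariant under the rescaling `ξ ↦ 2π ξ`. [folklore] -/
theorem preimage_smul_closedForwardCone_subset :
    (fun ξ : SpaceTime d => (2 * Real.pi) • ξ) ⁻¹' closedForwardCone d ⊆ closedForwardCone d := by
  intro ξ hξ
  rw [mem_preimage, mem_closedForwardCone_iff, map_smul, norm_smul, PiLp.smul_apply, smul_eq_mul,
    Real.norm_of_nonneg (by positivity)] at hξ
  rw [mem_closedForwardCone_iff]
  nlinarith [Real.pi_pos, norm_nonneg (spaceC d ξ)]

/-- **`T̂` vanishes near momenta with `−∑_{j ≥ m} pⱼ ∉ V̄₊`** (Streater–Wightman (1964),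
Thm. 3-2 (b): the spectral condition W0 through `apply_translationAverage_tail_eq_zero`, with the
cutoff criterion `SchwartzSupport.isVanishingOnCompact_preimage`).
[cite: StreaterWightman1964, §3-3 Thm 3-2 (b)] -/
theorem isVanishingOnCompact_tail (hW : IsWightmanQFT W) (hT : IsWightmanDistributionOf W n k T)
    (A : SpaceTime d →L[ℝ] (Fin n → SpaceTime d)) {m : ℕ} (hmn : m ≤ n)
    (hA : ∀ (a : SpaceTime d) (j : Fin n), A a j = if m ≤ (j : ℕ) then a else 0) :
    SchwartzSupport.IsVanishingOnCompact
      ((T.comp (SchwartzMap.compCLMOfContinuousLinearEquiv ℂ (flattenCLE d n))).comp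
        (FourierTransform.fourierInvCLM ℂ 𝓢(EuclideanSpace ℝ (Fin n × Fin (d + 1)), ℂ)))
      ((-ContinuousLinearMap.adjoint ((flattenCLE d n : _ →L[ℝ] _).comp A)) ⁻¹'
        (closedForwardCone d)ᶜ) := by
  refine SchwartzSupport.isVanishingOnCompact_preimage _ _ isClosed_closedForwardCone.isOpen_compl
    fun θ hθs hθc hθW G => ?_
  have hθs' : ContDiff ℝ ∞ fun x => (θ x : ℂ) := Complex.ofRealCLM.contDiff.comp hθs
  have hθc' : HasCompactSupport fun x => (θ x : ℂ) := hθc.comp_left Complex.ofReal_zero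
  rw [← averagingMultiplier_fourier_toSchwartzMap _ hθs' hθc', fourierSide_apply_smulLeftCLM]
  refine apply_translationAverage_tail_eq_zero hW hT A hmn hA ?_ _
  have h1 : tsupport (⇑(hθc'.toSchwartzMap hθs')) ⊆ tsupport θ :=
    closure_mono (Function.support_comp_subset Complex.ofReal_zero θ)
  refine h1.trans (hθW.trans ?_)
  exact compl_subset_compl.2 preimage_smul_closedForwardCone_subset

/-- **`T̂` vanishes near momenta with `∑ⱼ pⱼ ≠ 0`** (translation invariance (3-21) through
`apply_translationAverage_all`: the symbol weight `θ` vanishes at `0`).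
[cite: StreaterWightman1964, §3-3 eq (3-21)] -/
theorem isVanishingOnCompact_all (hW : IsWightmanQFT W) (hT : IsWightmanDistributionOf W n k T)
    (A : SpaceTime d →L[ℝ] (Fin n → SpaceTime d)) (hA : ∀ (a : SpaceTime d) (j : Fin n), A a j = a) :
    SchwartzSupport.IsVanishingOnCompact
      ((T.comp (SchwartzMap.compCLMOfContinuousLinearEquiv ℂ (flattenCLE d n))).comp
        (FourierTransform.fourierInvCLM ℂ 𝓢(EuclideanSpace ℝ (Fin n × Fin (d + 1)), ℂ)))
      ((-ContinuousLinearMap.adjoint ((flattenCLE d n : _ →L[ℝ] _).comp A)) ⁻¹' ({0} : Set _)ᶜ) := by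
  refine SchwartzSupport.isVanishingOnCompact_preimage _ _ isOpen_compl_singleton
    fun θ hθs hθc hθW G => ?_
  have hθs' : ContDiff ℝ ∞ fun x => (θ x : ℂ) := Complex.ofRealCLM.contDiff.comp hθs
  have hθc' : HasCompactSupport fun x => (θ x : ℂ) := hθc.comp_left Complex.ofReal_zero
  rw [← averagingMultiplier_fourier_toSchwartzMap _ hθs' hθc', fourierSide_apply_smulLeftCLM,
    apply_translationAverage_all hW hT A hA]
  have h0 : θ 0 = 0 := image_eq_zero_of_notMem_tsupport fun h => hθW h rfl
  change (θ 0 : ℂ) * _ = 0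
  rw [h0, Complex.ofReal_zero, zero_mul]

end Vanishing

/-! ### The cover of the complement of the spectral set -/

/-- Splitting the total momentum at `k`: `∑_{j ≥ k+1} pⱼ + ∑_{j ≤ k} pⱼ = ∑ⱼ pⱼ` (the partial
sum written as a cut-off sum, as in `WightmanTubeLaplace`'s `sum_Iic_eq_sum_ite`). [folklore] -/
theorem sum_ite_succ_le_add_sum_Iic {M : Type*} [AddCommMonoid M] (p : Fin n → M) (k : Fin n) :
    (∑ j : Fin n, if (k : ℕ) + 1 ≤ (j : ℕ) then p j else 0) + ∑ j ∈ Finset.Iic k, p j =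
      ∑ j, p j := by
  have hIic : ∑ j ∈ Finset.Iic k, p j = ∑ j, if j ≤ k then p j else 0 := by
    rw [Finset.sum_ite, Finset.sum_const_zero, add_zero]
    congr 1
    ext j
    simp
  rw [hIic, ← Finset.sum_add_distrib]
  refine Finset.sum_congr rfl fun j _ => ?_
  by_cases h : (k : ℕ) + 1 ≤ (j : ℕ)
  · have h' : ¬ j ≤ k := fun h' => by rw [Fin.le_def] at h'; omega
    rw [if_pos h, if_neg h', add_zero]
  · have h' : j ≤ k := by rw [Fin.le_def]; omega
    rw [if_neg h, if_pos h', zero_add]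

/-- **The complement of the spectral set is covered** by the sets where `T̂` vanishes: a
momentum off `{∑ pⱼ = 0, ∑_{j ≤ k} pⱼ ∈ V̄₊ ∀ k}` has `∑ pⱼ ≠ 0` or, for some `1 ≤ m < n`,
`−∑_{j ≥ m} pⱼ = ∑_{j ≤ m−1} pⱼ ∉ V̄₊`. [folklore] -/
theorem compl_image_spectralSet_subset (A : ℕ → (SpaceTime d →L[ℝ] (Fin n → SpaceTime d)))
    (hA : ∀ (m : ℕ) (a : SpaceTime d) (j : Fin n), A m a j = if m ≤ (j : ℕ) then a else 0) :
    (flattenCLE d n '' spectralSet d n)ᶜ ⊆ ⋃ j : Fin n,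
      (if (j : ℕ) = 0 then
        (-ContinuousLinearMap.adjoint ((flattenCLE d n : _ →L[ℝ] _).comp (A 0))) ⁻¹' ({0} : Set _)ᶜ
      else
        (-ContinuousLinearMap.adjoint ((flattenCLE d n : _ →L[ℝ] _).comp (A j))) ⁻¹'
          (closedForwardCone d)ᶜ) := by
  intro q hq
  set p : Fin n → SpaceTime d := (flattenCLE d n).symm q with hp
  have hq' : q = flattenCLE d n p := by rw [hp, ContinuousLinearEquiv.apply_symm_apply]
  have hpS : p ∉ spectralSet d n := fun h => hq ⟨p, h, hq'.symm⟩
  rw [mem_spectralSet_iff, not_and_or] at hpS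
  rw [mem_iUnion]
  -- the adjoints
  have hadj : ∀ m : ℕ, (-ContinuousLinearMap.adjoint ((flattenCLE d n : _ →L[ℝ] _).comp (A m))) q
      = -∑ j : Fin n, if m ≤ (j : ℕ) then p j else 0 := fun m => by
    change -(ContinuousLinearMap.adjoint ((flattenCLE d n : _ →L[ℝ] _).comp (A m)) q) = _
    rw [adjoint_tail_apply (A m) (hA m) q]
  rcases hpS with hsum | hpart
  · -- total momentum nonzero
    have hn : 0 < n := Nat.pos_of_ne_zero fun h0 =>
      hsum (Finset.sum_eq_zero fun j _ => absurd j.2 (by omega))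
    refine ⟨⟨0, hn⟩, ?_⟩
    rw [if_pos rfl, mem_preimage, hadj 0, mem_compl_iff, mem_singleton_iff, neg_eq_zero]
    simpa using hsum
  · -- a partial sum outside the cone
    rw [not_forall] at hpart
    obtain ⟨k₀, hk₀⟩ := hpart
    by_cases hsum : ∑ j, p j = 0
    · have hk : (k₀ : ℕ) + 1 < n := by
        by_contra hk
        have hlast : Finset.Iic k₀ = Finset.univ := by
          ext j
          simp only [Finset.mem_Iic, Finset.mem_univ, iff_true, Fin.le_def]
          omega
        rw [hlast, hsum] at hk₀
        exact hk₀ (by simp)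
      refine ⟨⟨(k₀ : ℕ) + 1, hk⟩, ?_⟩
      rw [if_neg (Nat.succ_ne_zero _), mem_preimage, hadj, mem_compl_iff]
      have e : -(∑ j : Fin n, if (k₀ : ℕ) + 1 ≤ (j : ℕ) then p j else 0) =
          ∑ j ∈ Finset.Iic k₀, p j := by
        rw [neg_eq_iff_eq_neg, eq_neg_iff_add_eq_zero, sum_ite_succ_le_add_sum_Iic, hsum]
      rwa [e]
    · have hn : 0 < n := k₀.pos
      refine ⟨⟨0, hn⟩, ?_⟩
      rw [if_pos rfl, mem_preimage, hadj 0, mem_compl_iff, mem_singleton_iff, neg_eq_zero]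
      simpa using hsum

/-! ### The theorem -/

/-- **Spectral condition for the Wightman distributions of a Wightman QFT — the named fact
`IsWightmanQFT.hasSpectralCondition_family` holds** (Streater–Wightman (1964), §3-3,
Thm. 3-2 (b), eqs. (3-27)–(3-32)). [cite: StreaterWightman1964, §3-3 Thm 3-2 (b)] -/
theorem _root_.Literature.MathematicalPhysics.QuantumLattice.IsWightmanQFT.hasSpectralCondition_family_holds
    {W : WightmanData d κ} : IsWightmanQFT.hasSpectralCondition_family (W := W) := by
  intro hW 𝒲 h𝒲 n k F hdisj
  choose A hA using fun m : ℕ => exists_tailEmbed (d := d) (n := n) m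
  set T : 𝓢((Fin n → SpaceTime d), ℂ) →L[ℂ] ℂ := 𝒲 n k with hTdef
  set unflat : 𝓢(EuclideanSpace ℝ (Fin n × Fin (d + 1)), ℂ) →L[ℂ] 𝓢((Fin n → SpaceTime d), ℂ) :=
    SchwartzMap.compCLMOfContinuousLinearEquiv ℂ (flattenCLE d n) with hunflat
  set That : 𝓢(EuclideanSpace ℝ (Fin n × Fin (d + 1)), ℂ) →L[ℂ] ℂ := (T.comp unflat).comp
    (FourierTransform.fourierInvCLM ℂ 𝓢(EuclideanSpace ℝ (Fin n × Fin (d + 1)), ℂ)) with hThat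
  set U : Fin n → Set (EuclideanSpace ℝ (Fin n × Fin (d + 1))) := fun j =>
    if (j : ℕ) = 0 then
      (-ContinuousLinearMap.adjoint ((flattenCLE d n : _ →L[ℝ] _).comp (A 0))) ⁻¹' ({0} : Set _)ᶜ
    else
      (-ContinuousLinearMap.adjoint ((flattenCLE d n : _ →L[ℝ] _).comp (A j))) ⁻¹'
        (closedForwardCone d)ᶜ with hU
  have hUo : ∀ j, IsOpen (U j) := fun j => by
    simp only [hU]
    split_ifs
    · exact isOpen_compl_singleton.preimage (ContinuousLinearMap.continuous _)
    · exact isClosed_closedForwardCone.isOpen_compl.preimage (ContinuousLinearMap.continuous _)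
  have hvan : ∀ j, SchwartzSupport.IsVanishingOnCompact That (U j) := fun j => by
    simp only [hU, hThat]
    split_ifs with hj
    · exact isVanishingOnCompact_all hW (h𝒲 n k) (A 0) fun a j' => by simp [hA]
    · exact isVanishingOnCompact_tail hW (h𝒲 n k) (A j) j.2.le (hA j)
  have hglue := SchwartzSupport.isVanishingOn_iUnion That hUo hvan
  have hcover := compl_image_spectralSet_subset (d := d) (n := n) A hA
  have hTF : 𝒲 n k F = That (𝓕 (flattenTest F)) := by
    simp only [hThat, hTdef, hunflat, ContinuousLinearMap.comp_apply,
      FourierTransform.fourierInvCLM_apply, FourierTransform.fourierInv_fourier_eq]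
    congr 1
  rw [hTF]
  exact hglue _ ((subset_compl_iff_disjoint_right.2 hdisj).trans hcover)

end Literature.Analysis.FunctionSpaces
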